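import Summits.AnomalousDissipation.AnomalousDissipation.Theorems.SolenoidalFractalHomogenisationLagrangianStepVmodFlatPointwise
import Summits.AnomalousDissipation.AnomalousDissipation.Theorems.SolenoidalFractalHomogenisationLagrangianStepVmodTextsEH
import HarnessLib

/-!
# K1L_D (stmt-AnomalousDissipation-27980): (V_mod) flat stage, block (ss) ⇐ single real mode pairs — W7 binder threaded (the «EH twins» of
# `bssNZ_of_ssMode` / `bss_of_bssNZ` / `bss_of_ssMode`, prover ad-sawtooth-k1loc-p1 g14 p707653)
(line file of the (V_mod) lane; prover lead-k1l-onelevel-p1 g6; tenure RULING D27-13″ (3): the hand-over from the (ss) taker's target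
`VmodFlat.SSMode_textEH e` (successor prover ad-sawtooth-k1loc-p1 g15) to the `Bss_textEH e` slot of `lossFlatW_of_blocksEVH` (prover ad-k1loc-p3 g9).)

Three-line corollaries of prover ad-k1loc-p3 g9's POINTWISE bodies `blockBound_slowNZ_of_ssMode_at` / `blockBound_slow_of_slowNZ_at`
(`…VmodFlatPointwise`, p708585) over the texts `SSMode_textEH`, `BssNZ_textEH`, `Bss_textEH` (`…VmodTextsEH`, p708799):
* `bssNZ_of_ssModeH : SSMode_textEH e → BssNZ_textEH e`;
* `bss_of_bssNZH : BssNZ_textEH e → Bss_textEH e`;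
* **`bss_of_ssModeH : SSMode_textEH e → Bss_textEH e`**.
`sorry`-free; NOT a proof of (ss), of `stub_Vmod_of_VRH`, of K1L_D or AD; rung F-D1.A0.
-/

set_option linter.dupNamespace false

noncomputable section

namespace Summit.AnomalousDissipation.AnomalousDissipation.Theorems.SolenoidalFractalHomogenisation.LagrangianStep.VmodFlat

open Literature.Analysis Literature.Analysis.FluidPDE Literature.Analysis.FunctionSpaces
open MeasureTheory Set Filter UnitAddTorus
open scoped ENNReal NNReal InnerProductSpace
open Summit.AnomalousDissipation.AnomalousDissipation.Theorems.SolenoidalFractalHomogenisation.LagrangianStep.CellClauseMod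

/-- **(ss) on nonzero slow data ⇐ the single-pair modewise bound, W7 binder threaded** (twin of `bssNZ_of_ssMode`). -/
theorem bssNZ_of_ssModeH (e : ℝ → ℝ) (h : SSMode_textEH e) : BssNZ_textEH e := by
  intro k W M hM c hc Φ lo hi Λ β σ C ν₀ K hlo hlo1 hhi hΛ hβ hσ hC hν₀ hν₀1 hK hV hH
  obtain ⟨C₁, hCC₁, hmode⟩ := h k W M hM c hc Φ lo hi Λ β σ C ν₀ K hlo hlo1 hhi hΛ hβ hσ hC hν₀ hν₀1 hK hV hH
  exact ⟨C₁, hCC₁, blockBound_slowNZ_of_ssMode_at W M hM hc Φ hlo hΛ hK (hC.trans hCC₁) hmode⟩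

/-- **(ss) ⇐ (ss) on nonzero slow data, W7 binder threaded** (twin of `bss_of_bssNZ`: the constant mode decouples). -/
theorem bss_of_bssNZH (e : ℝ → ℝ) (h : BssNZ_textEH e) : Bss_textEH e := by
  intro k W M hM c hc Φ lo hi Λ β σ C ν₀ K hlo hlo1 hhi hΛ hβ hσ hC hν₀ hν₀1 hK hV hH
  obtain ⟨C₁, hCC₁, B⟩ := h k W M hM c hc Φ lo hi Λ β σ C ν₀ K hlo hlo1 hhi hΛ hβ hσ hC hν₀ hν₀1 hK hV hH
  exact ⟨C₁, hCC₁, blockBound_slow_of_slowNZ_at W M hM hc Φ hlo hK (hC.trans hCC₁) B⟩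

/-- **(ss) with the W7 binder ⇐ the single-pair modewise bound with the binder** (`bssNZ_of_ssModeH` then `bss_of_bssNZH`) — the hand-over from
`SSMode_textEH e` to the `Bss_textEH e` slot of `lossFlatW_of_blocksEVH`. -/
theorem bss_of_ssModeH (e : ℝ → ℝ) (h : SSMode_textEH e) : Bss_textEH e := bss_of_bssNZH e (bssNZ_of_ssModeH e h)

end Summit.AnomalousDissipation.AnomalousDissipation.Theorems.SolenoidalFractalHomogenisation.LagrangianStep.VmodFlat

end
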